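import Summits.ResolutionOfSingularities.ResolutionOfSingularities.Theorems.FrobeniusLadderFInjectiveMacaulayficationConeFibreClauseAt
import HarnessLib

/-!
# (F4c-direct) The extended-Rees chart clause from the CONE where it is good and DIRECTLY where it is not (engine v2, brick D1)
# (crux `FInjectiveMacaulayfication` stmt-ResolutionOfSingularities-15315; RULING R15.48 (3) of res-L1-w45a-plan-1: relative filtered engine v2
# for rows whose weighted tangent cone has finitely many bad orbits although the blow-up is FULL there — the F192/5 phenomenon)

Support file (helper), chain w45a, seat res-L1-w45a-stub-4 g6. [OURS · L1 W4.5a; variant of res-L1-w45a-lead-1's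
`FilteredChartClauseV.filteredRees_hclB_v`] — NOT a statement of the manuscript; AI-written, weaker than expert review.

SETTING (the filtered engine's): `f ∈ k[X₀..X_{n-1}]` with initial `w`-form `f₀` of weight `D`, the deformation
`fh = Σ_b coeff_b(f) X^b s^{w·b − D} ∈ k[X, s]` (`s = X none`; `fh|_{s=0} = f₀`, `fh|_{s=1} = f`), the chart ring
`B = (k[X,s]/(fh))[1/X_v^c]` of the `v`-th chart of the weighted blow-up (extended Rees presentation).  The engine needs the crux
clause of `B` at every maximal ideal `P ∋ s` (the exceptional locus).  `filteredRees_hclB_v` gets it by DEFORMATION from the clause of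
the cone `k[X]/(f₀)` at the point under `P` (E1, `CMFI deforms`) — so it needs the cone good at EVERY closed point off `V(x̄_v)`.

**`filteredRees_hclB_direct`** asks instead, at each maximal `P′` of `k[X,s]/(fh)` with `X_v ∉ P′ ∋ s`, for EITHER the clause of
`k[X,s]/(fh)` at `P′` DIRECTLY (a hypersurface point: Fedder / Jacobian on `fh`, e.g. `FedderViaSlicing`) OR the clause of the cone at the
maximal ideals `Q₀` of `k[X]/(f₀)` «under `P′`» — handed to the user with the DICTIONARY `x̄_j ∈ Q₀ ↔ X_j ∈ P′` (so a user whose bad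
cone locus `Z` is cut out by coordinates decides the branch by `X_j ∈ P′`).  Conclusion unchanged: `B_P` is a domain satisfying the
clause at every maximal `P ∋ s`.  Cone branch = `ConeFibreClauseAt.coneFibreClause_at` (brick (c1), p562421); direct branch =
transport along `(k[X,s]/(fh))_{P′} ≅ B_P`.  Specimen: F192/5 (`T₁₁ + t²yzw²`, facet `(2,3,9,3 | 18)`): the cone is bad along ONE orbit
`O = {x=y=z=t=0}` but `fh = z² + (y²+x³)³ + t²yzw² + x¹¹s⁴ + w⁷s³` is F-pure at the points over `O` (`fh⁴ ∋ 12·w¹¹·t⁴y²z⁴s³`).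
No definitions, no named facts. [folklore]
-/

-- single-problem summit: the doubled namespace component is forced
set_option linter.dupNamespace false

noncomputable section

namespace Summit.ResolutionOfSingularities.ResolutionOfSingularities.Theorems.FInjectiveMacaulayfication.FilteredReesHclBDirect

open IsLocalRing
open Summit.ResolutionOfSingularities.ResolutionOfSingularities.Theorems.FInjectiveMacaulayfication

/-- **(F4c-direct)** The clause (and domain-ness) of `B = (k[X,s]/(fh))[1/X_v^c]` at every maximal `P ∋ s`, from the DISJUNCTIVE
hypothesis «direct clause of `k[X,s]/(fh)` at `P′ = P ∩ k[X,s]/(fh)`, or the cone clause at the maximal ideals `Q₀` of `k[X]/(f₀)` with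
`x̄_j ∈ Q₀ ↔ X_j ∈ P′`». [cite: Fedder1983, Thm. 3.4 (1)]; folklore. -/
theorem filteredRees_hclB_direct (p : ℕ) [Fact p.Prime] (k : Type) [Field k] [CharP k p] (n : ℕ) (w : Fin n → ℕ) (D : ℕ)
    (f : MvPolynomial (Fin n) k) (fh : MvPolynomial (Option (Fin n)) k)
    (hfh : fh = ∑ b ∈ f.support, MvPolynomial.monomial
      (Finsupp.mapDomain some b + Finsupp.single none (Finsupp.weight w b - D)) (MvPolynomial.coeff b f))
    (hD0 : ∀ m < D, MvPolynomial.weightedHomogeneousComponent w m f = 0)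
    (f₀ : MvPolynomial (Fin n) k) (hf₀ : f₀ = MvPolynomial.weightedHomogeneousComponent w D f) (hD : f₀ ≠ 0)
    (hfprime : (Ideal.span {f}).IsPrime) (hXne : ∀ j : Fin n, Ideal.Quotient.mk (Ideal.span {f}) (MvPolynomial.X j) ≠ 0)
    (v : Fin n) (c : ℕ) (hc : 0 < c)
    (hcone : ∀ (P' : Ideal (MvPolynomial (Option (Fin n)) k ⧸ Ideal.span {fh})) [P'.IsMaximal],
      Ideal.Quotient.mk (Ideal.span {fh}) (MvPolynomial.X (some v)) ∉ P' →
      Ideal.Quotient.mk (Ideal.span {fh}) (MvPolynomial.X none) ∈ P' →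
      (∀ d : ℕ, ringKrullDim (Localization.AtPrime P') = d → ∀ t : Fin d → Localization.AtPrime P',
        (Ideal.span (Set.range t)).radical.IsMaximal →
          RingTheory.Sequence.IsWeaklyRegular (Localization.AtPrime P') (List.ofFn t) ∧
          ∀ y : Localization.AtPrime P', (∃ e : ℕ, y ^ p ^ e ∈ Ideal.span
            ((fun z : Localization.AtPrime P' => z ^ p ^ e) ''
              (Ideal.span (Set.range t) : Set (Localization.AtPrime P')))) → y ∈ Ideal.span (Set.range t)) ∨
      (∀ (Q₀ : Ideal (MvPolynomial (Fin n) k ⧸ Ideal.span {f₀})) [Q₀.IsMaximal],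
        (∀ j : Fin n, Ideal.Quotient.mk (Ideal.span {f₀}) (MvPolynomial.X j) ∈ Q₀ ↔
          Ideal.Quotient.mk (Ideal.span {fh}) (MvPolynomial.X (some j)) ∈ P') →
        ∀ d : ℕ, ringKrullDim (Localization.AtPrime Q₀) = d → ∀ t : Fin d → Localization.AtPrime Q₀,
          (Ideal.span (Set.range t)).radical.IsMaximal →
            RingTheory.Sequence.IsWeaklyRegular (Localization.AtPrime Q₀) (List.ofFn t) ∧
            ∀ y : Localization.AtPrime Q₀, (∃ e : ℕ, y ^ p ^ e ∈ Ideal.span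
              ((fun z : Localization.AtPrime Q₀ => z ^ p ^ e) ''
                (Ideal.span (Set.range t) : Set (Localization.AtPrime Q₀)))) → y ∈ Ideal.span (Set.range t)))
    (P : Ideal (Localization.Away (Ideal.Quotient.mk (Ideal.span {fh}) (MvPolynomial.X (some v)) ^ c))) [P.IsMaximal]
    (hsP : algebraMap (MvPolynomial (Option (Fin n)) k ⧸ Ideal.span {fh})
      (Localization.Away (Ideal.Quotient.mk (Ideal.span {fh}) (MvPolynomial.X (some v)) ^ c))
      (Ideal.Quotient.mk (Ideal.span {fh}) (MvPolynomial.X none)) ∈ P) :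
    IsDomain (Localization.AtPrime P) ∧
      ∀ d : ℕ, ringKrullDim (Localization.AtPrime P) = d → ∀ t : Fin d → Localization.AtPrime P,
        (Ideal.span (Set.range t)).radical.IsMaximal →
          RingTheory.Sequence.IsWeaklyRegular (Localization.AtPrime P) (List.ofFn t) ∧
          ∀ y : Localization.AtPrime P, (∃ e : ℕ, y ^ p ^ e ∈ Ideal.span
            ((fun z : Localization.AtPrime P => z ^ p ^ e) ''
              (Ideal.span (Set.range t) : Set (Localization.AtPrime P)))) → y ∈ Ideal.span (Set.range t) := by
  have hD' : MvPolynomial.weightedHomogeneousComponent w D f ≠ 0 := hf₀ ▸ hD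
  haveI := FilteredReesDomain.isDomain_reesAway w D f fh hfh hD0 hD' hfprime hXne v c
  haveI := FilteredReesDomain.charP_reesAway p w D f fh hfh hD0 hD' hfprime hXne v c
  haveI : IsNoetherianRing (Localization.Away (Ideal.Quotient.mk (Ideal.span {fh}) (MvPolynomial.X (some v)) ^ c)) :=
    Algebra.FiniteType.isNoetherianRing k _
  haveI : IsJacobsonRing (MvPolynomial (Option (Fin n)) k ⧸ Ideal.span {fh}) :=
    isJacobsonRing_of_finiteType (A := k) (B := MvPolynomial (Option (Fin n)) k ⧸ Ideal.span {fh})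
  -- the contraction `P′ = P ∩ k[X,s]/(fh)`: maximal, misses `X_v`, contains `s`
  have hPu := (IsLocalization.isMaximal_iff_isMaximal_disjoint
    (Localization.Away (Ideal.Quotient.mk (Ideal.span {fh}) (MvPolynomial.X (some v)) ^ c))
    (Ideal.Quotient.mk (Ideal.span {fh}) (MvPolynomial.X (some v)) ^ c) P).mp inferInstance
  haveI : (P.under (MvPolynomial (Option (Fin n)) k ⧸ Ideal.span {fh})).IsMaximal := hPu.1
  have hv : Ideal.Quotient.mk (Ideal.span {fh}) (MvPolynomial.X (some v)) ∉
      P.under (MvPolynomial (Option (Fin n)) k ⧸ Ideal.span {fh}) :=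
    fun h => hPu.2 (Ideal.pow_mem_of_mem _ h c hc)
  have hs : Ideal.Quotient.mk (Ideal.span {fh}) (MvPolynomial.X none) ∈
      P.under (MvPolynomial (Option (Fin n)) k ⧸ Ideal.span {fh}) := Ideal.mem_comap.mpr hsP
  rcases hcone (P.under (MvPolynomial (Option (Fin n)) k ⧸ Ideal.span {fh})) hv hs with hdirect | hconeQ
  · -- DIRECT branch: transport along `(k[X,s]/(fh))_{P′} ≅ B_P`
    have e : Localization.AtPrime (P.under (MvPolynomial (Option (Fin n)) k ⧸ Ideal.span {fh})) ≃+*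
        Localization.AtPrime P :=
      (IsLocalization.localizationLocalizationAtPrimeIsoLocalization
        (Submonoid.powers (Ideal.Quotient.mk (Ideal.span {fh}) (MvPolynomial.X (some v)) ^ c)) P).toRingEquiv
    refine ⟨IsLocalization.isDomain_localization (Ideal.primeCompl_le_nonZeroDivisors P), ?_⟩
    exact DegreeZeroDescent.inlineClause_of_ringEquiv p
      (L := Localization.AtPrime (P.under (MvPolynomial (Option (Fin n)) k ⧸ Ideal.span {fh})))
      (L' := Localization.AtPrime P) e hdirect
  · -- CONE branch: deformation from the cone point under `P`, with the coordinate dictionary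
    obtain ⟨π, hπa, hπ, hker⟩ := FilteredReesFibre.exists_fibreMap w D f fh hfh hD0 f₀ hf₀ v c
    refine ConeFibreClauseAt.coneFibreClause_at p k n f₀ v c hc
      (Localization.Away (Ideal.Quotient.mk (Ideal.span {fh}) (MvPolynomial.X (some v)) ^ c)) _
      (FilteredReesDomain.algebraMap_mk_X_none_ne_zero w D f fh hfh hD0 hD' hfprime hXne v c) π hπ hker P hsP
      (fun 𝔪 _ h𝔪 Q₀ _ hQ₀ _ => hconeQ Q₀ fun j => ?_)
    -- `x̄_j ∈ Q₀ ↔ X_j ∈ P′`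
    have hπj : π (algebraMap _ _ (Ideal.Quotient.mk (Ideal.span {fh}) (MvPolynomial.X (some j)))) =
        algebraMap _ _ (Ideal.Quotient.mk (Ideal.span {f₀}) (MvPolynomial.X j)) := by
      rw [hπa, MvPolynomial.aeval_X]
      rfl
    rw [hQ₀, Ideal.under, Ideal.mem_comap, ← hπj, ← Ideal.mem_comap, h𝔪, Ideal.under, Ideal.mem_comap]

end Summit.ResolutionOfSingularities.ResolutionOfSingularities.Theorems.FInjectiveMacaulayfication.FilteredReesHclBDirect

end
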